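import Literature.MathematicalPhysics.QuantumLattice.FendleyYangSupercharge
import Literature.MathematicalPhysics.QuantumLattice.ProductOperators
import Literature.MathematicalPhysics.QuantumLattice.SpinOperators
import Literature.MathematicalPhysics.QuantumLattice.InfiniteVolumeSpinEntriesProofs
import HarnessLib

/-!
# The supersymmetric Hamiltonian `H = Q Q† + Q† Q` of the Fendley–Yang supercharge is the open
# XXZ chain at `Δ = -1/2` (Hagendorf–Liénardy 2017, §2)

Topic `MathematicalPhysics/QuantumLattice`; continuation of `FendleyYangSupercharge.lean` (the
length-raising supercharge `Q = fendleyYangSupercharge L : V^L → V^{L+1}`, `Q² = 0`) in the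
vocabulary of `SpinSystem` / `ProductOperators` / `SpinOperators` (`Op (Fin L) 2`, `onSite`,
`productOp`, `spinHalfPauli`; entries of two-site products `onSite_mul_onSite_apply` from
`InfiniteVolumeSpinEntriesProofs`).

Source: C. Hagendorf, J. Liénardy, *Open spin chains with dynamic lattice supersymmetry*, J. Phys.
A 50 (2017) 185202 = arXiv:1612.02951, §2 [HagendorfLienardy2017], read in the held text:
"In supersymmetric quantum mechanics, the Hamiltonian is given by the anticommutator of a
supercharge `Q` and its adjoint `Q†`: `H = Q Q† + Q† Q`" (eqn. DefHFromQ); "`H Q = Q H`,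
`H Q† = Q† H`" (eqn. CommuteHQ); and, for the `ℓ = 1` local supercharge `q|0⟩ = 0`,
`q|1⟩ = |0⟩ ⊗ |0⟩` of Fendley–Yang with `|0⟩ = (1,0)ᵀ`, `|1⟩ = (0,1)ᵀ` and the Pauli matrices:
"Indeed, one finds the XXZ Hamiltonian with anisotropy parameter `Δ = -1/2` and diagonal boundary
magnetic fields:
`H = -½ Σ_{j=1}^{L-1} (σ¹ⱼσ¹ⱼ₊₁ + σ²ⱼσ²ⱼ₊₁ - ½ σ³ⱼσ³ⱼ₊₁) - (σ³₁ + σ³_L)/4 + (3L - 1)/4`"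
(eqn. XXZOpenChainND).

## Contents (everything proved)

* `fendleyYangHamiltonian L : Op (Fin L) 2` — `H_L = Q_L† Q_L + Q_{L-1} Q_{L-1}†` (on `V^0 = ℂ`
  only the first term); `fendleyYangHamiltonian_isHermitian`;
  `fendleyYangHamiltonian_mul_supercharge : H_{L+1} Q_L = Q_L H_L` and
  `fendleyYangHamiltonian_mul_conjTranspose_supercharge : H_L Q_L† = Q_L† H_{L+1}` (dynamic
  supersymmetry, from `Q² = 0`).
* `xxzOpenHamiltonian n : Op (Fin (n+1)) 2` — the printed right-hand side for the chain of length
  `L = n + 1` (sites `Fin (n+1)`, bonds `(i.castSucc, i.succ)`, `i : Fin n`; boundary fields at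
  `0` and `Fin.last n`, which coincide for `L = 1` exactly as `σ³₁ + σ³_L = 2σ³₁` does).
* The site-supercharge calculus behind the identification (HL2017 §2, eqns. HamiltonianDensity,
  BoundaryHamiltonian): `qⱼ† qⱼ = n↓ⱼ`, `qᵢ† qᵢ₊₁ = σ⁻ᵢ σ⁺ᵢ₊₁`, `qⱼ qⱼ† = P↑ⱼ P↑ⱼ₊₁`, and the
  exchange relation `qᵢ† qⱼ₊₁ = qⱼ qᵢ†` (`i < j`) making all non-nearest-neighbour terms of
  `Q†Q` cancel against `QQ†`.
* `fendleyYangHamiltonian_succ_eq_xxz : H_{n+1} = xxzOpenHamiltonian n` — the printed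
  identification, for every length `L = n + 1 ≥ 1`.

## References

* C. Hagendorf, J. Liénardy, J. Phys. A 50 (2017) 185202, arXiv:1612.02951, §2. [HagendorfLienardy2017]
* X. Yang, P. Fendley, *Non-local spacetime supersymmetry on the lattice*, J. Phys. A 37 (2004)
  8937. [YangFendley2004]
-/

noncomputable section

open Matrix Complex Finset
open Literature.MathematicalPhysics.QuantumLattice.FendleyYang

namespace Literature.MathematicalPhysics.QuantumLattice

/-! ### The Hamiltonian and its dynamic supersymmetry -/

/-- The **supersymmetric Hamiltonian** `H = Q Q† + Q† Q` of the Fendley–Yang supercharge on the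
chain of length `L` (`V^L`): `H_L = Q_L† Q_L + Q_{L-1} Q_{L-1}†`, with `Q_L : V^L → V^{L+1}` and
`Q_{L-1}† : V^L → V^{L-1}` (on `V^0` there is no second term). Hagendorf–Liénardy 2017, §2,
eqn. (DefHFromQ). [cite: HagendorfLienardy2017, §2 eqn. (H = QQ† + Q†Q)] -/
def fendleyYangHamiltonian : (L : ℕ) → Op (Fin L) 2
  | 0 => (fendleyYangSupercharge 0)ᴴ * fendleyYangSupercharge 0
  | L + 1 => (fendleyYangSupercharge (L + 1))ᴴ * fendleyYangSupercharge (L + 1) +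
      fendleyYangSupercharge L * (fendleyYangSupercharge L)ᴴ

/-- Unfolding on the empty chain (where in fact `Q_0 = 0`, so `H_0 = 0`). [folklore] -/
theorem fendleyYangHamiltonian_zero :
    fendleyYangHamiltonian 0 = (fendleyYangSupercharge 0)ᴴ * fendleyYangSupercharge 0 := rfl

/-- Unfolding `H_{L+1} = Q_{L+1}† Q_{L+1} + Q_L Q_L†`. [cite: HagendorfLienardy2017, §2 eqn. (H = QQ† + Q†Q)] -/
theorem fendleyYangHamiltonian_succ (L : ℕ) :
    fendleyYangHamiltonian (L + 1) =
      (fendleyYangSupercharge (L + 1))ᴴ * fendleyYangSupercharge (L + 1) +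
        fendleyYangSupercharge L * (fendleyYangSupercharge L)ᴴ := rfl

/-- `H_0 = 0`. [folklore] -/
@[simp] theorem fendleyYangHamiltonian_zero_eq_zero : fendleyYangHamiltonian 0 = 0 := by
  rw [fendleyYangHamiltonian_zero, supercharge_zero, Matrix.mul_zero]

/-- `H` is Hermitian (`(Q†Q)† = Q†Q`, `(QQ†)† = QQ†`) (HL2017 §2: the spectrum is real and
non-negative). [cite: HagendorfLienardy2017, §2] -/
theorem fendleyYangHamiltonian_isHermitian (L : ℕ) : (fendleyYangHamiltonian L).IsHermitian := by
  cases L with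
  | zero => simp
  | succ L =>
    rw [fendleyYangHamiltonian_succ]
    exact (Matrix.isHermitian_conjTranspose_mul_self _).add (Matrix.isHermitian_mul_conjTranspose_self _)

/-- **Dynamic supersymmetry** `H Q = Q H` (HL2017 §2, eqn. CommuteHQ): precisely
`H_{L+1} Q_L = Q_L H_L` as maps `V^L → V^{L+1}`, from `Q² = 0`.
[cite: HagendorfLienardy2017, §2 eqn. (HQ = QH)] -/
theorem fendleyYangHamiltonian_mul_supercharge (L : ℕ) :
    fendleyYangHamiltonian (L + 1) * fendleyYangSupercharge L =
      fendleyYangSupercharge L * fendleyYangHamiltonian L := by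
  cases L with
  | zero => simp
  | succ L =>
    rw [fendleyYangHamiltonian_succ, fendleyYangHamiltonian_succ, Matrix.add_mul, Matrix.mul_add,
      Matrix.mul_assoc _ (fendleyYangSupercharge (L + 1 + 1)) (fendleyYangSupercharge (L + 1)),
      fendleyYangSupercharge_sq, Matrix.mul_zero, zero_add,
      ← Matrix.mul_assoc (fendleyYangSupercharge (L + 1)) (fendleyYangSupercharge L),
      fendleyYangSupercharge_sq, Matrix.zero_mul, add_zero, Matrix.mul_assoc]

/-- `H Q† = Q† H` (HL2017 §2, eqn. CommuteHQ): `H_L Q_L† = Q_L† H_{L+1}` as maps `V^{L+1} → V^L`.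
[cite: HagendorfLienardy2017, §2 eqn. (HQ† = Q†H)] -/
theorem fendleyYangHamiltonian_mul_conjTranspose_supercharge (L : ℕ) :
    fendleyYangHamiltonian L * (fendleyYangSupercharge L)ᴴ =
      (fendleyYangSupercharge L)ᴴ * fendleyYangHamiltonian (L + 1) := by
  have h := congr_arg Matrix.conjTranspose (fendleyYangHamiltonian_mul_supercharge L)
  rw [Matrix.conjTranspose_mul, Matrix.conjTranspose_mul,
    (fendleyYangHamiltonian_isHermitian (L + 1)).eq, (fendleyYangHamiltonian_isHermitian L).eq] at h
  exact h.symm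

/-! ### Single-site matrices -/

/-- `n↓ = |1⟩⟨1| = (1 - σ³)/2`, the projector onto spin down. [folklore] -/
def nDown : Matrix (Fin 2) (Fin 2) ℂ := !![0, 0; 0, 1]

/-- `P↑ = |0⟩⟨0| = (1 + σ³)/2`, the projector onto spin up. [folklore] -/
def pUp : Matrix (Fin 2) (Fin 2) ℂ := !![1, 0; 0, 0]

/-- `σ⁺ = |0⟩⟨1|` (raises `↓ ↦ ↑`). [folklore] -/
def sPlus : Matrix (Fin 2) (Fin 2) ℂ := !![0, 1; 0, 0]

/-- `σ⁻ = |1⟩⟨0|` (lowers `↑ ↦ ↓`). [folklore] -/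
def sMinus : Matrix (Fin 2) (Fin 2) ℂ := !![0, 0; 1, 0]

/-- Entries of `n↓`. [folklore] -/
theorem nDown_apply (a b : Fin 2) : nDown a b = if a = 1 ∧ b = 1 then 1 else 0 := by
  fin_cases a <;> fin_cases b <;> rfl

/-- Entries of `P↑`. [folklore] -/
theorem pUp_apply (a b : Fin 2) : pUp a b = if a = 0 ∧ b = 0 then 1 else 0 := by
  fin_cases a <;> fin_cases b <;> rfl

/-- Entries of `σ⁺`. [folklore] -/
theorem sPlus_apply (a b : Fin 2) : sPlus a b = if a = 0 ∧ b = 1 then 1 else 0 := by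
  fin_cases a <;> fin_cases b <;> rfl

/-- Entries of `σ⁻`. [folklore] -/
theorem sMinus_apply (a b : Fin 2) : sMinus a b = if a = 1 ∧ b = 0 then 1 else 0 := by
  fin_cases a <;> fin_cases b <;> rfl

/-! ### Entries of `qᵢ† qⱼ` and `qᵢ qⱼ†` -/

namespace FendleyYang

variable {L : ℕ}

/-- The entries of `q_j` are `0` or `1`, so `star` acts trivially. [folklore] -/
theorem star_siteSupercharge_apply (j : Fin L) (τ : TensorIndex (Fin (L + 1)) 2)
    (σ : TensorIndex (Fin L) 2) : star (siteSupercharge j τ σ) = siteSupercharge j τ σ := by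
  rw [siteSupercharge_apply]
  split_ifs <;> simp

/-- **Entries of `qᵢ† qⱼ : V^L → V^L`**:
`⟨τ| qᵢ† qⱼ |σ⟩ = [τᵢ = 1 ∧ σⱼ = 1 ∧ insertPair i τ = insertPair j σ]`.
[cite: HagendorfLienardy2017, §2 (def. of q_j)] -/
theorem conjTranspose_siteSupercharge_mul_apply (i j : Fin L) (τ σ : TensorIndex (Fin L) 2) :
    ((siteSupercharge i)ᴴ * siteSupercharge j) τ σ =
      if τ i = 1 ∧ σ j = 1 ∧ insertPair i τ = insertPair j σ then 1 else 0 := by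
  rw [Matrix.mul_apply]
  by_cases hσ : σ j = 1
  · rw [Finset.sum_eq_single (insertPair j σ)]
    · rw [Matrix.conjTranspose_apply, star_siteSupercharge_apply,
        siteSupercharge_apply j (insertPair j σ) σ, if_pos ⟨hσ, rfl⟩, mul_one, siteSupercharge_apply]
      by_cases h : τ i = 1 ∧ insertPair j σ = insertPair i τ
      · rw [if_pos h, if_pos ⟨h.1, hσ, h.2.symm⟩]
      · rw [if_neg h, if_neg (fun h' => h ⟨h'.1, h'.2.2.symm⟩)]
    · intro ρ _ hρ
      rw [siteSupercharge_apply j, if_neg (fun h => hρ h.2), mul_zero]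
    · intro h
      exact absurd (Finset.mem_univ _) h
  · rw [if_neg (fun h => hσ h.2.1)]
    refine Finset.sum_eq_zero fun ρ _ => ?_
    rw [siteSupercharge_apply j, if_neg (fun h => hσ h.1), mul_zero]

/-- **Entries of `qᵢ qⱼ† : V^{L+1} → V^{L+1}`**: `⟨τ| qᵢ qⱼ† |σ⟩ = 1` iff there is `ρ ∈ V^L` with
`ρᵢ = ρⱼ = 1`, `τ = insertPair i ρ`, `σ = insertPair j ρ` (such `ρ` is unique), and `0` otherwise.
[cite: HagendorfLienardy2017, §2 (def. of q_j)] -/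
theorem siteSupercharge_mul_conjTranspose_apply (i j : Fin L) (τ σ : TensorIndex (Fin (L + 1)) 2) :
    (siteSupercharge i * (siteSupercharge j)ᴴ) τ σ =
      if ∃ ρ : TensorIndex (Fin L) 2, ρ i = 1 ∧ τ = insertPair i ρ ∧ ρ j = 1 ∧ σ = insertPair j ρ
      then 1 else 0 := by
  rw [Matrix.mul_apply]
  by_cases h : ∃ ρ : TensorIndex (Fin L) 2, ρ i = 1 ∧ τ = insertPair i ρ ∧ ρ j = 1 ∧ σ = insertPair j ρ
  · obtain ⟨ρ, hρi, hτ, hρj, hσ⟩ := h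
    rw [if_pos ⟨ρ, hρi, hτ, hρj, hσ⟩, Finset.sum_eq_single ρ]
    · rw [Matrix.conjTranspose_apply, star_siteSupercharge_apply, siteSupercharge_apply,
        siteSupercharge_apply, if_pos ⟨hρi, hτ⟩, if_pos ⟨hρj, hσ⟩, mul_one]
    · intro ρ' _ hρ'
      rw [Matrix.conjTranspose_apply, star_siteSupercharge_apply, siteSupercharge_apply,
        siteSupercharge_apply]
      by_cases h1 : ρ' i = 1 ∧ τ = insertPair i ρ'
      · exact absurd (insertPair_injective_of_eq (h1.1.trans hρi.symm) (h1.2.symm.trans hτ)) hρ'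
      · rw [if_neg h1, zero_mul]
    · intro h'
      exact absurd (Finset.mem_univ _) h'
  · rw [if_neg h]
    refine Finset.sum_eq_zero fun ρ _ => ?_
    rw [Matrix.conjTranspose_apply, star_siteSupercharge_apply, siteSupercharge_apply,
      siteSupercharge_apply]
    by_cases h1 : ρ i = 1 ∧ τ = insertPair i ρ
    · by_cases h2 : ρ j = 1 ∧ σ = insertPair j ρ
      · exact absurd ⟨ρ, h1.1, h1.2, h2.1, h2.2⟩ h
      · rw [if_neg h2, mul_zero]
    · rw [if_neg h1, zero_mul]

/-! ### Collapsing a pair of sites -/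

/-- `collapsePair j v τ`: the configuration of length `L` obtained from `τ ∈ V^{L+1}` by replacing
the two sites `j, j+1` by a single site carrying `v` (a one-sided inverse of `insertPair j`).
[folklore] -/
def collapsePair (j : Fin L) (v : Fin 2) (τ : TensorIndex (Fin (L + 1)) 2) : TensorIndex (Fin L) 2 :=
  fun k => if k < j then τ k.castSucc else if k = j then v else τ k.succ

/-- The collapsed configuration carries `v` at `j`. [folklore] -/
@[simp] theorem collapsePair_apply_self (j : Fin L) (v : Fin 2) (τ : TensorIndex (Fin (L + 1)) 2) :
    collapsePair j v τ j = v := by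
  simp [collapsePair]

/-- Left of `j` the collapsed configuration reads `τ`. [folklore] -/
theorem collapsePair_apply_of_lt {i j : Fin L} (h : i < j) (v : Fin 2)
    (τ : TensorIndex (Fin (L + 1)) 2) : collapsePair j v τ i = τ i.castSucc := by
  simp [collapsePair, h]

/-- Right of `j` the collapsed configuration reads `τ` shifted. [folklore] -/
theorem collapsePair_apply_of_gt {i j : Fin L} (h : j < i) (v : Fin 2)
    (τ : TensorIndex (Fin (L + 1)) 2) : collapsePair j v τ i = τ i.succ := by
  have h1 : ¬ i < j := not_lt.mpr h.le
  have h2 : i ≠ j := ne_of_gt h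
  simp [collapsePair, h1, h2]

/-- If `τ` carries `↑↑` at `j, j+1`, re-inserting the pair recovers `τ`:
`insertPair j (collapsePair j v τ) = τ`. [folklore] -/
theorem insertPair_collapsePair {j : Fin L} {τ : TensorIndex (Fin (L + 1)) 2}
    (h0 : τ j.castSucc = 0) (h1 : τ j.succ = 0) (v : Fin 2) :
    insertPair j (collapsePair j v τ) = τ := by
  symm
  rw [eq_insertPair_iff]
  exact ⟨fun i hi => (collapsePair_apply_of_lt hi v τ).symm, h0, h1,
    fun i hi => (collapsePair_apply_of_gt hi v τ).symm⟩

/-! ### `qⱼ† qⱼ = n↓ⱼ`, `qᵢ† qᵢ₊₁ = σ⁻ᵢ σ⁺ᵢ₊₁`, `qⱼ qⱼ† = P↑ⱼ P↑ⱼ₊₁` -/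

/-- **`qⱼ† qⱼ = n↓ⱼ`**: splitting site `j` and merging back is the projector onto `σⱼ = ↓`
(HL2017 §2: the terms `q†q ⊗ 1`, `1 ⊗ q†q` of `h` and `h_B = ½ q†q`).
[cite: HagendorfLienardy2017, §2 eqns. (h) and (h_B)] -/
theorem conjTranspose_siteSupercharge_mul_self (j : Fin L) :
    (siteSupercharge j)ᴴ * siteSupercharge j = onSite j nDown := by
  ext τ σ
  rw [conjTranspose_siteSupercharge_mul_apply, onSite_apply, nDown_apply]
  by_cases h : τ j = 1 ∧ σ j = 1 ∧ insertPair j τ = insertPair j σ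
  · have hτσ : τ = σ := insertPair_injective_of_eq (h.1.trans h.2.1.symm) h.2.2
    subst hτσ
    rw [if_pos h, if_pos (fun y _ => rfl), if_pos ⟨h.1, h.1⟩]
  · rw [if_neg h]
    split_ifs with h1 h2
    · exfalso
      apply h
      have hτσ : τ = σ := by
        funext y
        by_cases hy : y = j
        · rw [hy, h2.1, h2.2]
        · exact h1 y hy
      subst hτσ
      exact ⟨h2.1, h2.1, rfl⟩
    · rfl
    · rfl

/-! ### The nearest-neighbour equation `insertPair i τ = insertPair (i+1) σ` -/

/-- The equation `insertPair i.castSucc τ = insertPair i.succ σ` between neighbouring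
insertions, solved: `τ`, `σ` agree off `{i, i+1}`, `σᵢ = ↑` and `τᵢ₊₁ = ↑`. [folklore] -/
theorem insertPair_castSucc_eq_insertPair_succ_iff (i : Fin L) (τ σ : TensorIndex (Fin (L + 1)) 2) :
    insertPair i.castSucc τ = insertPair i.succ σ ↔
      (∀ z, z ≠ i.castSucc → z ≠ i.succ → τ z = σ z) ∧ σ i.castSucc = 0 ∧ τ i.succ = 0 := by
  have hcs : (i.castSucc : Fin (L + 1)) < i.succ := Fin.castSucc_lt_succ
  constructor
  · intro E
    refine ⟨fun z hz1 hz2 => ?_, ?_, ?_⟩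
    · rcases lt_or_gt_of_ne hz1 with hz | hz
      · have h := congr_fun E z.castSucc
        rwa [insertPair_apply_castSucc_of_lt hz, insertPair_apply_castSucc_of_lt (lt_trans hz hcs)] at h
      · have hz' : i.succ < z := lt_of_le_of_ne (Fin.castSucc_lt_iff_succ_le.mp hz) (Ne.symm hz2)
        have h := congr_fun E z.succ
        rwa [insertPair_apply_succ_of_lt hz, insertPair_apply_succ_of_lt hz'] at h
    · have h := congr_fun E i.castSucc.castSucc
      rw [insertPair_apply_castSucc_self, insertPair_apply_castSucc_of_lt hcs] at h
      exact h.symm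
    · have h := congr_fun E i.succ.succ
      rwa [insertPair_apply_succ_of_lt hcs, insertPair_apply_succ_self] at h
  · rintro ⟨hoff, hσ, hτ⟩
    refine (eq_insertPair_iff i.succ σ (insertPair i.castSucc τ)).2 ⟨fun z hz => ?_, ?_, ?_, fun z hz => ?_⟩
    · rcases lt_or_eq_of_le (Fin.le_castSucc_iff.mpr hz) with hz' | hz'
      · rw [insertPair_apply_castSucc_of_lt hz']
        exact hoff z (ne_of_lt hz') (ne_of_lt hz)
      · rw [hz', insertPair_apply_castSucc_self]
        exact hσ.symm
    · rw [← Fin.succ_castSucc, insertPair_apply_succ_self]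
    · rw [insertPair_apply_succ_of_lt hcs]
      exact hτ
    · rw [insertPair_apply_succ_of_lt (lt_trans hcs hz)]
      exact hoff z (ne_of_gt (lt_trans hcs hz)) (ne_of_gt hz)

/-- **`qᵢ† qᵢ₊₁ = σ⁻ᵢ σ⁺ᵢ₊₁`** (sites `i.castSucc`, `i.succ` of the chain `Fin (L+1)`): merging at
`i` what was split at `i+1` hops the down spin from `i+1` to `i`, `|…↑↓…⟩ ↦ |…↓↑…⟩` — the term
`(q† ⊗ 1)(1 ⊗ q)` of the Hamiltonian density (HL2017 §2, eqn. HamiltonianDensity).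
[cite: HagendorfLienardy2017, §2 eqn. (h)] -/
theorem conjTranspose_siteSupercharge_castSucc_mul_succ (i : Fin L) :
    (siteSupercharge (L := L + 1) i.castSucc)ᴴ * siteSupercharge i.succ =
      onSite i.castSucc sMinus * onSite i.succ sPlus := by
  have hne : (i.castSucc : Fin (L + 1)) ≠ i.succ := (Fin.castSucc_lt_succ (i := i)).ne
  ext τ σ
  rw [conjTranspose_siteSupercharge_mul_apply, onSite_mul_onSite_apply hne, sMinus_apply, sPlus_apply]
  by_cases hoff : ∀ z, z ≠ i.castSucc → z ≠ i.succ → τ z = σ z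
  · rw [if_pos hoff]
    by_cases hc : τ i.castSucc = 1 ∧ σ i.succ = 1 ∧ insertPair i.castSucc τ = insertPair i.succ σ
    · rw [if_pos hc]
      obtain ⟨hτ, hσ, E⟩ := hc
      obtain ⟨-, hσ0, hτ0⟩ := (insertPair_castSucc_eq_insertPair_succ_iff i τ σ).1 E
      rw [if_pos ⟨hτ, hσ0⟩, if_pos ⟨hτ0, hσ⟩, mul_one]
    · rw [if_neg hc]
      by_cases hA : τ i.castSucc = 1 ∧ σ i.castSucc = 0
      · by_cases hB : τ i.succ = 0 ∧ σ i.succ = 1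
        · exact absurd ⟨hA.1, hB.2,
            (insertPair_castSucc_eq_insertPair_succ_iff i τ σ).2 ⟨hoff, hA.2, hB.1⟩⟩ hc
        · rw [if_neg hB, mul_zero]
      · rw [if_neg hA, zero_mul]
  · rw [if_neg hoff, if_neg]
    rintro ⟨-, -, E⟩
    exact hoff ((insertPair_castSucc_eq_insertPair_succ_iff i τ σ).1 E).1

/-- **`qⱼ qⱼ† = P↑ⱼ P↑ⱼ₊₁`** on `V^{L+1}` (`qⱼ : V^L → V^{L+1}`): the projector onto `↑↑` at the sites
`j.castSucc, j.succ` — the term `q q†` of the Hamiltonian density (HL2017 §2, eqn.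
HamiltonianDensity). [cite: HagendorfLienardy2017, §2 eqn. (h)] -/
theorem siteSupercharge_mul_conjTranspose_self (j : Fin L) :
    siteSupercharge j * (siteSupercharge j)ᴴ =
      (onSite j.castSucc pUp * onSite j.succ pUp : Op (Fin (L + 1)) 2) := by
  have hne : (j.castSucc : Fin (L + 1)) ≠ j.succ := (Fin.castSucc_lt_succ (i := j)).ne
  ext τ σ
  rw [siteSupercharge_mul_conjTranspose_apply, onSite_mul_onSite_apply hne, pUp_apply, pUp_apply]
  by_cases h : ∃ ρ : TensorIndex (Fin L) 2, ρ j = 1 ∧ τ = insertPair j ρ ∧ ρ j = 1 ∧ σ = insertPair j ρ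
  · rw [if_pos h]
    obtain ⟨ρ, -, hτ, -, hσ⟩ := h
    have hτσ : σ = τ := hσ.trans hτ.symm
    subst hτσ
    rw [if_pos (fun z _ _ => rfl), hτ, insertPair_apply_castSucc_self, insertPair_apply_succ_self]
    simp
  · rw [if_neg h]
    by_cases h1 : ∀ z, z ≠ j.castSucc → z ≠ j.succ → τ z = σ z
    · rw [if_pos h1]
      by_cases h2 : τ j.castSucc = 0 ∧ σ j.castSucc = 0
      · by_cases h3 : τ j.succ = 0 ∧ σ j.succ = 0
        · exfalso
          apply h
          have hτσ : τ = σ := by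
            funext z
            by_cases hz1 : z = j.castSucc
            · rw [hz1, h2.1, h2.2]
            · by_cases hz2 : z = j.succ
              · rw [hz2, h3.1, h3.2]
              · exact h1 z hz1 hz2
          subst hτσ
          exact ⟨collapsePair j 1 τ, collapsePair_apply_self j 1 τ,
            (insertPair_collapsePair h2.1 h3.1 1).symm, collapsePair_apply_self j 1 τ,
            (insertPair_collapsePair h2.1 h3.1 1).symm⟩
        · rw [if_neg h3, mul_zero]
      · rw [if_neg h2, zero_mul]
    · rw [if_neg h1]

/-! ### The exchange relation `qᵢ† qⱼ₊₁ = qⱼ qᵢ†` for `i < j` -/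

/-- **Exchange relation** (adjoint form of `q_i q_j = q_{j+1} q_i`): for `i < j`,
`qᵢ† qⱼ₊₁ = qⱼ qᵢ†` as maps `V^{L+1} → V^{L+1}` (left: `qᵢ, qⱼ₊₁ : V^{L+1} → V^{L+2}`, sites
`i.castSucc`, `j.succ`; right: `qᵢ, qⱼ : V^L → V^{L+1}`). This is why all terms of `Q†Q` between
non-neighbouring sites cancel against `QQ†` (HL2017 §2: `H` is a sum of nearest-neighbour
densities). [cite: HagendorfLienardy2017, §2 eqn. (H = Σ h_{i,i+1} + h_B)] -/
theorem conjTranspose_siteSupercharge_castSucc_mul_succ_of_lt {i j : Fin L} (hij : i < j) :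
    (siteSupercharge (L := L + 1) i.castSucc)ᴴ * siteSupercharge j.succ =
      siteSupercharge j * (siteSupercharge i)ᴴ := by
  have hcs : (i.castSucc : Fin (L + 1)) < j.castSucc := Fin.castSucc_lt_castSucc_iff.mpr hij
  have hcs' : (i.castSucc : Fin (L + 1)) < j.succ := lt_trans hcs Fin.castSucc_lt_succ
  ext τ σ
  rw [conjTranspose_siteSupercharge_mul_apply, siteSupercharge_mul_conjTranspose_apply]
  congr 1
  apply propext
  constructor
  · rintro ⟨hτ, hσ, E⟩
    -- `τ` carries `↑↑` at `j, j+1`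
    have h0 : τ j.castSucc = 0 := by
      have h := congr_fun E j.castSucc.succ
      rw [insertPair_apply_succ_of_lt hcs, Fin.succ_castSucc, insertPair_apply_castSucc_self] at h
      exact h
    have h1 : τ j.succ = 0 := by
      have h := congr_fun E j.succ.succ
      rw [insertPair_apply_succ_of_lt hcs', insertPair_apply_succ_self] at h
      exact h
    set ρ := collapsePair j 1 τ with hρ
    have hins : insertPair j ρ = τ := insertPair_collapsePair h0 h1 1
    have hρi : ρ i = 1 := by rw [hρ, collapsePair_apply_of_lt hij, hτ]
    refine ⟨ρ, collapsePair_apply_self j 1 τ, hins.symm, hρi, ?_⟩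
    have E' : insertPair j.succ (insertPair i ρ) = insertPair j.succ σ := by
      rw [← insertPair_comm hij ρ, hins, E]
    refine (insertPair_injective_of_eq ?_ E').symm
    rw [insertPair_apply_succ_of_lt hij, hρ, collapsePair_apply_self, hσ]
  · rintro ⟨ρ, hρj, hτ, hρi, hσ⟩
    refine ⟨?_, ?_, ?_⟩
    · rw [hτ, insertPair_apply_castSucc_of_lt hij, hρi]
    · rw [hσ, insertPair_apply_succ_of_lt hij, hρj]
    · rw [hτ, hσ, insertPair_comm hij]

/-! ### Splitting double sums over `Fin (n+1)` into diagonal, nearest and further pairs -/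

section Sums

variable {M : Type*} [AddCommMonoid M]

/-- `Σ_{a,b} f a b = Σ_a f a a + Σ_{a<b} (f a b + f b a)`. [folklore] -/
theorem sum_sum_eq_sum_diag_add_sum_lt {m : ℕ} (f : Fin m → Fin m → M) :
    ∑ a, ∑ b, f a b = ∑ a, f a a + ∑ a, ∑ b, if a < b then f a b + f b a else 0 := by
  have key : ∀ a b, f a b =
      (if a = b then f a b else 0) + ((if a < b then f a b else 0) + (if b < a then f a b else 0)) := by
    intro a b
    rcases lt_trichotomy a b with h | rfl | h
    · rw [if_neg h.ne, if_pos h, if_neg (lt_asymm h), zero_add, add_zero]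
    · simp
    · rw [if_neg h.ne', if_neg (lt_asymm h), if_pos h, zero_add, zero_add]
  have h1 : ∑ a, ∑ b, f a b =
      ∑ a, ∑ b, (if a = b then f a b else 0) +
        (∑ a, ∑ b, (if a < b then f a b else 0) + ∑ a, ∑ b, (if b < a then f a b else 0)) := by
    simp only [← Finset.sum_add_distrib]
    exact Finset.sum_congr rfl fun a _ => Finset.sum_congr rfl fun b _ => key a b
  rw [h1]
  congr 1
  · exact Finset.sum_congr rfl fun a _ => by rw [Finset.sum_ite_eq]; simp
  · rw [Finset.sum_comm (f := fun a b => if b < a then f a b else 0), ← Finset.sum_add_distrib]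
    refine Finset.sum_congr rfl fun a _ => ?_
    rw [← Finset.sum_add_distrib]
    refine Finset.sum_congr rfl fun b _ => ?_
    rw [ite_add_ite, add_zero]

/-- The pairs `a < b` of `Fin (n+1)` are the pairs `(i.castSucc, j.succ)` with `i ≤ j` in `Fin n`. [folklore] -/
theorem sum_sum_ite_lt_eq_castSucc_succ {n : ℕ} (h : Fin (n + 1) → Fin (n + 1) → M) :
    ∑ a, ∑ b, (if a < b then h a b else 0) =
      ∑ i : Fin n, ∑ j : Fin n, if i ≤ j then h i.castSucc j.succ else 0 := by
  rw [Fin.sum_univ_castSucc]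
  have hlast : ∑ b : Fin (n + 1), (if Fin.last n < b then h (Fin.last n) b else 0) = 0 :=
    Finset.sum_eq_zero fun b _ => if_neg (not_lt.mpr (Fin.le_last b))
  rw [hlast, add_zero]
  refine Finset.sum_congr rfl fun i _ => ?_
  rw [Fin.sum_univ_succ, if_neg (not_lt.mpr (Fin.zero_le _)), zero_add]
  refine Finset.sum_congr rfl fun j _ => ?_
  by_cases hij : i ≤ j
  · rw [if_pos (Fin.le_castSucc_iff.mp (Fin.castSucc_le_castSucc_iff.mpr hij)), if_pos hij]
  · rw [if_neg (fun h => hij (Fin.castSucc_le_castSucc_iff.mp (Fin.le_castSucc_iff.mpr h))), if_neg hij]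

/-- `Σ_{i ≤ j} k i j = Σ_i k i i + Σ_{i<j} k i j`. [folklore] -/
theorem sum_sum_ite_le_eq {m : ℕ} (k : Fin m → Fin m → M) :
    ∑ i, ∑ j, (if i ≤ j then k i j else 0) = ∑ i, k i i + ∑ i, ∑ j, if i < j then k i j else 0 := by
  have key : ∀ i j, (if i ≤ j then k i j else 0) = (if i = j then k i j else 0) + (if i < j then k i j else 0) := by
    intro i j
    rcases lt_trichotomy i j with h | rfl | h
    · rw [if_pos h.le, if_neg h.ne, if_pos h, zero_add]
    · simp
    · rw [if_neg (not_le.mpr h), if_neg h.ne', if_neg (lt_asymm h), zero_add]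
  have h1 : ∑ i, ∑ j, (if i ≤ j then k i j else 0) =
      ∑ i, ∑ j, (if i = j then k i j else 0) + ∑ i, ∑ j, (if i < j then k i j else 0) := by
    simp only [← Finset.sum_add_distrib]
    exact Finset.sum_congr rfl fun i _ => Finset.sum_congr rfl fun j _ => key i j
  rw [h1]
  congr 1
  exact Finset.sum_congr rfl fun i _ => by rw [Finset.sum_ite_eq]; simp

end Sums

/-! ### `H = Σ n↓ + Σ P↑P↑ − Σ (σ⁻σ⁺ + h.c.)`: only nearest-neighbour terms survive -/

/-- The signs `(-1)^{j+1}` of `Q = Σ (-1)^{j+1} q_j` (`0`-based sites). [folklore] -/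
def sgn (k : ℕ) : ℂ := (-1) ^ (k + 1)

/-- `sgn k ^ 2 = 1`. [folklore] -/
@[simp] theorem sgn_mul_self (k : ℕ) : sgn k * sgn k = 1 := by
  rw [sgn, ← mul_pow]; simp

/-- The signs alternate. [folklore] -/
@[simp] theorem sgn_succ (k : ℕ) : sgn (k + 1) = -sgn k := by
  rw [sgn, sgn, pow_succ]; ring

/-- The signs are real. [folklore] -/
@[simp] theorem star_sgn (k : ℕ) : star (sgn k) = sgn k := by
  simp [sgn]

/-- `Q_m = Σ_a sgn a • q_a`. [folklore] -/
theorem supercharge_eq_sum_sgn (m : ℕ) :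
    fendleyYangSupercharge m = ∑ a : Fin m, sgn a.val • siteSupercharge a := supercharge_def m

/-- `Q_m† = Σ_a sgn a • q_a†`. [folklore] -/
theorem conjTranspose_supercharge_eq_sum_sgn (m : ℕ) :
    (fendleyYangSupercharge m)ᴴ = ∑ a : Fin m, sgn a.val • (siteSupercharge a)ᴴ := by
  rw [supercharge_eq_sum_sgn, Matrix.conjTranspose_sum]
  exact Finset.sum_congr rfl fun a _ => by rw [Matrix.conjTranspose_smul, star_sgn]

/-- `Q_m† Q_m = Σ_{a,b} (sgn a sgn b) • q_a† q_b`. [folklore] -/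
theorem conjTranspose_supercharge_mul_supercharge (m : ℕ) :
    (fendleyYangSupercharge m)ᴴ * fendleyYangSupercharge m =
      ∑ a : Fin m, ∑ b : Fin m, (sgn a.val * sgn b.val) • ((siteSupercharge a)ᴴ * siteSupercharge b) := by
  rw [conjTranspose_supercharge_eq_sum_sgn, supercharge_eq_sum_sgn, Matrix.sum_mul]
  refine Finset.sum_congr rfl fun a _ => ?_
  rw [Matrix.mul_sum]
  refine Finset.sum_congr rfl fun b _ => ?_
  rw [Matrix.smul_mul, Matrix.mul_smul, smul_smul, mul_comm]

/-- `Q_m Q_m† = Σ_{a,b} (sgn a sgn b) • q_a q_b†`. [folklore] -/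
theorem supercharge_mul_conjTranspose_supercharge (m : ℕ) :
    fendleyYangSupercharge m * (fendleyYangSupercharge m)ᴴ =
      ∑ a : Fin m, ∑ b : Fin m, (sgn a.val * sgn b.val) • (siteSupercharge a * (siteSupercharge b)ᴴ) := by
  rw [conjTranspose_supercharge_eq_sum_sgn, supercharge_eq_sum_sgn, Matrix.sum_mul]
  refine Finset.sum_congr rfl fun a _ => ?_
  rw [Matrix.mul_sum]
  refine Finset.sum_congr rfl fun b _ => ?_
  rw [Matrix.smul_mul, Matrix.mul_smul, smul_smul, mul_comm]

/-- **The Hamiltonian in terms of nearest-neighbour local operators** (HL2017 §2, eqns.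
Hamiltonian, HamiltonianDensity, BoundaryHamiltonian, specialised to the Fendley–Yang `q`):
`H_{n+1} = Σ_{a} n↓_a + Σ_{i} (P↑ᵢ P↑ᵢ₊₁ − σ⁻ᵢ σ⁺ᵢ₊₁ − (σ⁻ᵢ σ⁺ᵢ₊₁)†)`, the further-neighbour
terms of `Q†Q` cancelling against `QQ†` by the exchange relation.
[cite: HagendorfLienardy2017, §2 eqns. (H = Σ h_{i,i+1} + h_B), (h), (h_B)] -/
theorem fendleyYangHamiltonian_succ_eq_local (n : ℕ) :
    fendleyYangHamiltonian (n + 1) =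
      ∑ a : Fin (n + 1), onSite a nDown +
        ∑ i : Fin n, (onSite i.castSucc pUp * onSite i.succ pUp -
          (onSite i.castSucc sMinus * onSite i.succ sPlus + (onSite i.castSucc sMinus * onSite i.succ sPlus)ᴴ)) := by
  rw [fendleyYangHamiltonian_succ, conjTranspose_supercharge_mul_supercharge,
    supercharge_mul_conjTranspose_supercharge,
    sum_sum_eq_sum_diag_add_sum_lt
      (fun a b : Fin (n + 1) => (sgn a.val * sgn b.val) • ((siteSupercharge a)ᴴ * siteSupercharge b)),
    sum_sum_ite_lt_eq_castSucc_succ, sum_sum_ite_le_eq,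
    sum_sum_eq_sum_diag_add_sum_lt
      (fun a b : Fin n => (sgn a.val * sgn b.val) • (siteSupercharge a * (siteSupercharge b)ᴴ))]
  -- the further-neighbour terms cancel
  have hcancel : ∀ i j : Fin n, i < j →
      ((sgn (i.castSucc : Fin (n + 1)).val * sgn (j.succ : Fin (n + 1)).val) •
          ((siteSupercharge (L := n + 1) i.castSucc)ᴴ * siteSupercharge j.succ) +
        (sgn (j.succ : Fin (n + 1)).val * sgn (i.castSucc : Fin (n + 1)).val) •
          ((siteSupercharge (L := n + 1) j.succ)ᴴ * siteSupercharge i.castSucc)) +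
      ((sgn i.val * sgn j.val) • (siteSupercharge i * (siteSupercharge j)ᴴ) +
        (sgn j.val * sgn i.val) • (siteSupercharge j * (siteSupercharge i)ᴴ)) = 0 := by
    intro i j hij
    have hex := conjTranspose_siteSupercharge_castSucc_mul_succ_of_lt hij
    have hex' : (siteSupercharge (L := n + 1) j.succ)ᴴ * siteSupercharge i.castSucc =
        siteSupercharge i * (siteSupercharge j)ᴴ := by
      have := congr_arg Matrix.conjTranspose hex
      rwa [Matrix.conjTranspose_mul, Matrix.conjTranspose_conjTranspose, Matrix.conjTranspose_mul,
        Matrix.conjTranspose_conjTranspose] at this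
    rw [hex, hex', Fin.val_castSucc, Fin.val_succ, sgn_succ]
    rw [show (sgn i.val * -sgn j.val) = -(sgn j.val * sgn i.val) by ring,
      show (-sgn j.val * sgn i.val) = -(sgn i.val * sgn j.val) by ring, neg_smul, neg_smul]
    abel
  have hzero : ∑ i : Fin n, ∑ j : Fin n, (if i < j then
      ((sgn (i.castSucc : Fin (n + 1)).val * sgn (j.succ : Fin (n + 1)).val) •
          ((siteSupercharge (L := n + 1) i.castSucc)ᴴ * siteSupercharge j.succ) +
        (sgn (j.succ : Fin (n + 1)).val * sgn (i.castSucc : Fin (n + 1)).val) •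
          ((siteSupercharge (L := n + 1) j.succ)ᴴ * siteSupercharge i.castSucc)) else 0) +
      ∑ i : Fin n, ∑ j : Fin n, (if i < j then
        ((sgn i.val * sgn j.val) • (siteSupercharge i * (siteSupercharge j)ᴴ) +
          (sgn j.val * sgn i.val) • (siteSupercharge j * (siteSupercharge i)ᴴ)) else 0) = 0 := by
    rw [← Finset.sum_add_distrib]
    refine Finset.sum_eq_zero fun i _ => ?_
    rw [← Finset.sum_add_distrib]
    refine Finset.sum_eq_zero fun j _ => ?_
    rw [ite_add_ite, add_zero]
    split_ifs with hij
    · exact hcancel i j hij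
    · rfl
  -- diagonal and nearest-neighbour terms
  have hdiag : ∀ a : Fin (n + 1), (sgn a.val * sgn a.val) • ((siteSupercharge a)ᴴ * siteSupercharge a) =
      onSite a nDown := by
    intro a
    rw [sgn_mul_self, one_smul, conjTranspose_siteSupercharge_mul_self]
  have hdiag' : ∀ i : Fin n, (sgn i.val * sgn i.val) • (siteSupercharge i * (siteSupercharge i)ᴴ) =
      (onSite i.castSucc pUp * onSite i.succ pUp : Op (Fin (n + 1)) 2) := by
    intro i
    rw [sgn_mul_self, one_smul, siteSupercharge_mul_conjTranspose_self]
  have hnn : ∀ i : Fin n,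
      ((sgn (i.castSucc : Fin (n + 1)).val * sgn (i.succ : Fin (n + 1)).val) •
          ((siteSupercharge (L := n + 1) i.castSucc)ᴴ * siteSupercharge i.succ) +
        (sgn (i.succ : Fin (n + 1)).val * sgn (i.castSucc : Fin (n + 1)).val) •
          ((siteSupercharge (L := n + 1) i.succ)ᴴ * siteSupercharge i.castSucc)) =
      -(onSite i.castSucc sMinus * onSite i.succ sPlus + (onSite i.castSucc sMinus * onSite i.succ sPlus)ᴴ) := by
    intro i
    have hb := conjTranspose_siteSupercharge_castSucc_mul_succ i
    have hb' : (siteSupercharge (L := n + 1) i.succ)ᴴ * siteSupercharge i.castSucc =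
        (onSite i.castSucc sMinus * onSite i.succ sPlus)ᴴ := by
      rw [← hb, Matrix.conjTranspose_mul, Matrix.conjTranspose_conjTranspose]
    rw [hb, hb', Fin.val_castSucc, Fin.val_succ, sgn_succ, mul_neg, neg_mul, sgn_mul_self, neg_smul,
      neg_smul, one_smul, one_smul, neg_add]
  simp only [hdiag, hdiag', hnn]
  rw [show ∀ (A B C D E : Op (Fin (n + 1)) 2), A + (B + D) + (C + E) = A + (B + C) + (D + E) from
    fun _ _ _ _ _ => by abel, hzero, add_zero]
  congr 1
  rw [← Finset.sum_add_distrib]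
  exact Finset.sum_congr rfl fun i _ => by rw [sub_eq_add_neg]; exact add_comm _ _

end FendleyYang

/-! ### Pauli-matrix identities -/

/-- `n↓ = (1 - σ³)/2`. [folklore] -/
theorem nDown_eq : nDown = (1 / 2 : ℂ) • (1 - spinHalfPauli 2) := by
  ext a b
  fin_cases a <;> fin_cases b <;> simp [nDown, spinHalfPauli]
  norm_num

/-- `P↑ = (1 + σ³)/2`. [folklore] -/
theorem pUp_eq : pUp = (1 / 2 : ℂ) • (1 + spinHalfPauli 2) := by
  ext a b
  fin_cases a <;> fin_cases b <;> simp [pUp, spinHalfPauli]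
  norm_num

/-- `σ¹ = σ⁺ + σ⁻`. [folklore] -/
theorem spinHalfPauli_zero_eq : spinHalfPauli 0 = sPlus + sMinus := by
  ext a b
  fin_cases a <;> fin_cases b <;> simp [sPlus, sMinus, spinHalfPauli]

/-- `σ² = -iσ⁺ + iσ⁻`. [folklore] -/
theorem spinHalfPauli_one_eq : spinHalfPauli 1 = (-I) • sPlus + I • sMinus := by
  ext a b
  fin_cases a <;> fin_cases b <;> simp [sPlus, sMinus, spinHalfPauli]

/-- `(σ⁻)† = σ⁺`. [folklore] -/
theorem conjTranspose_sMinus : sMinusᴴ = sPlus := by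
  ext a b
  fin_cases a <;> fin_cases b <;> simp [sPlus, sMinus, Matrix.conjTranspose_apply]

/-- `(σ⁺)† = σ⁻`. [folklore] -/
theorem conjTranspose_sPlus : sPlusᴴ = sMinus := by
  ext a b
  fin_cases a <;> fin_cases b <;> simp [sPlus, sMinus, Matrix.conjTranspose_apply]

/-- **The hopping term**: for distinct sites `x ≠ y`,
`σ⁻ₓσ⁺_y + (σ⁻ₓσ⁺_y)† = σ⁻ₓσ⁺_y + σ⁺ₓσ⁻_y = ½ (σ¹ₓσ¹_y + σ²ₓσ²_y)`. [folklore] -/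
theorem hop_add_conjTranspose_eq {L : ℕ} {x y : Fin L} (hxy : x ≠ y) :
    (onSite x sMinus * onSite y sPlus + (onSite x sMinus * onSite y sPlus)ᴴ : Op (Fin L) 2) =
      (1 / 2 : ℂ) • (onSite x (spinHalfPauli 0) * onSite y (spinHalfPauli 0) +
        onSite x (spinHalfPauli 1) * onSite y (spinHalfPauli 1)) := by
  rw [Matrix.conjTranspose_mul, ← onSite_conjTranspose, ← onSite_conjTranspose, conjTranspose_sMinus,
    conjTranspose_sPlus, onSite_mul_onSite_comm (Ne.symm hxy), spinHalfPauli_zero_eq,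
    spinHalfPauli_one_eq]
  simp only [onSite_add', onSite_smul', add_mul, mul_add, smul_mul_assoc, mul_smul_comm, smul_add,
    smul_smul]
  rw [show (-I) * (-I) = -1 by rw [neg_mul_neg, Complex.I_mul_I],
    show I * (-I) = 1 by rw [mul_neg, Complex.I_mul_I, neg_neg],
    show (-I) * I = 1 by rw [neg_mul, Complex.I_mul_I, neg_neg], Complex.I_mul_I]
  module

/-! ### The open XXZ Hamiltonian at `Δ = -1/2` in Pauli form -/

/-- **The open XXZ Hamiltonian at `Δ = -1/2` with the supersymmetric diagonal boundary fields**
(Hagendorf–Liénardy 2017, eqn. XXZOpenChainND), for the chain of length `L = n + 1` on the sites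
`Fin (n+1)` (bonds `(i.castSucc, i.succ)`, `i : Fin n`; end sites `0` and `Fin.last n`):
`H = -½ Σ_{i} (σ¹ᵢσ¹ᵢ₊₁ + σ²ᵢσ²ᵢ₊₁ - ½ σ³ᵢσ³ᵢ₊₁) - (σ³₀ + σ³_last)/4 + (3L - 1)/4`.
[cite: HagendorfLienardy2017, §2 eqn. (XXZ Hamiltonian at Δ = -1/2)] -/
def xxzOpenHamiltonian (n : ℕ) : Op (Fin (n + 1)) 2 :=
  -(1 / 2 : ℂ) • ∑ i : Fin n, (onSite i.castSucc (spinHalfPauli 0) * onSite i.succ (spinHalfPauli 0) +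
      onSite i.castSucc (spinHalfPauli 1) * onSite i.succ (spinHalfPauli 1) -
      (1 / 2 : ℂ) • (onSite i.castSucc (spinHalfPauli 2) * onSite i.succ (spinHalfPauli 2))) -
    (1 / 4 : ℂ) • (onSite 0 (spinHalfPauli 2) + onSite (Fin.last n) (spinHalfPauli 2)) +
    ((3 * (n + 1 : ℂ) - 1) / 4) • (1 : Op (Fin (n + 1)) 2)

/-- The diagonal bookkeeping: `Σ_a n↓_a + Σ_i P↑ᵢ P↑ᵢ₊₁ = ¼ Σ_i σ³ᵢσ³ᵢ₊₁ - ¼ (σ³₀ + σ³_last)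
+ (3L-1)/4`, `L = n + 1` (with `n↓ = (1-σ³)/2`, `P↑P↑ = ¼(1+σ³)(1+σ³)` and the telescoping
`Σ_i (σ³_{i.castSucc} + σ³_{i.succ}) = 2 Σ_a σ³_a - σ³₀ - σ³_last`). [folklore] -/
theorem sum_nDown_add_sum_pUp_pUp (n : ℕ) :
    (∑ a : Fin (n + 1), onSite a nDown + ∑ i : Fin n, onSite i.castSucc pUp * onSite i.succ pUp :
        Op (Fin (n + 1)) 2) =
      (1 / 4 : ℂ) • ∑ i : Fin n, onSite i.castSucc (spinHalfPauli 2) * onSite i.succ (spinHalfPauli 2) -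
        (1 / 4 : ℂ) • (onSite 0 (spinHalfPauli 2) + onSite (Fin.last n) (spinHalfPauli 2)) +
        ((3 * (n + 1 : ℂ) - 1) / 4) • (1 : Op (Fin (n + 1)) 2) := by
  have hn : ∀ a : Fin (n + 1), (onSite a nDown : Op (Fin (n + 1)) 2) =
      (1 / 2 : ℂ) • 1 - (1 / 2 : ℂ) • onSite a (spinHalfPauli 2) := by
    intro a
    rw [nDown_eq, onSite_smul', onSite_sub', onSite_one', smul_sub]
  have hp : ∀ i : Fin n, (onSite i.castSucc pUp * onSite i.succ pUp : Op (Fin (n + 1)) 2) =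
      (1 / 4 : ℂ) • ((1 + onSite i.succ (spinHalfPauli 2)) +
        (onSite i.castSucc (spinHalfPauli 2) +
          onSite i.castSucc (spinHalfPauli 2) * onSite i.succ (spinHalfPauli 2))) := by
    intro i
    rw [pUp_eq, onSite_smul', onSite_smul', onSite_add', onSite_add', onSite_one', onSite_one',
      Matrix.smul_mul, Matrix.mul_smul, smul_smul, add_mul, mul_add, mul_add, one_mul, one_mul, mul_one]
    norm_num
  simp only [hn, hp]
  rw [Finset.sum_sub_distrib, Finset.sum_const, Finset.card_univ, Fintype.card_fin, ← Finset.smul_sum,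
    ← Finset.smul_sum]
  simp only [Finset.sum_add_distrib, Finset.sum_const, Finset.card_univ, Fintype.card_fin]
  -- telescoping
  have hcs : ∑ i : Fin n, (onSite i.castSucc (spinHalfPauli 2) : Op (Fin (n + 1)) 2) =
      ∑ a, onSite a (spinHalfPauli 2) - onSite (Fin.last n) (spinHalfPauli 2) :=
    eq_sub_of_add_eq (Fin.sum_univ_castSucc fun a : Fin (n + 1) => (onSite a (spinHalfPauli 2) :
      Op (Fin (n + 1)) 2)).symm
  have hsucc : ∑ i : Fin n, (onSite i.succ (spinHalfPauli 2) : Op (Fin (n + 1)) 2) =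
      ∑ a, onSite a (spinHalfPauli 2) - onSite 0 (spinHalfPauli 2) :=
    eq_sub_of_add_eq ((add_comm _ _).trans (Fin.sum_univ_succ fun a : Fin (n + 1) =>
      (onSite a (spinHalfPauli 2) : Op (Fin (n + 1)) 2)).symm)
  rw [hcs, hsucc, ← Nat.cast_smul_eq_nsmul ℂ (n + 1), ← Nat.cast_smul_eq_nsmul ℂ n]
  simp only [smul_add, smul_sub, smul_smul]
  push_cast
  module

/-- **`H = Q Q† + Q† Q` is the open XXZ chain at `Δ = -1/2`** (Hagendorf–Liénardy 2017, §2, eqn.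
XXZOpenChainND, for the Fendley–Yang supercharge): for every length `L = n + 1 ≥ 1`,
`H_{n+1} = -½ Σ_{i} (σ¹ᵢσ¹ᵢ₊₁ + σ²ᵢσ²ᵢ₊₁ - ½ σ³ᵢσ³ᵢ₊₁) - (σ³₀ + σ³_last)/4 + (3L - 1)/4`.
[cite: HagendorfLienardy2017, §2 eqn. (XXZ Hamiltonian at Δ = -1/2)] -/
theorem fendleyYangHamiltonian_succ_eq_xxz (n : ℕ) :
    fendleyYangHamiltonian (n + 1) = xxzOpenHamiltonian n := by
  rw [fendleyYangHamiltonian_succ_eq_local, Finset.sum_sub_distrib, ← add_sub_assoc,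
    sum_nDown_add_sum_pUp_pUp, xxzOpenHamiltonian]
  have hhop : ∀ i : Fin n,
      (onSite i.castSucc sMinus * onSite i.succ sPlus + (onSite i.castSucc sMinus * onSite i.succ sPlus)ᴴ :
          Op (Fin (n + 1)) 2) =
        (1 / 2 : ℂ) • (onSite i.castSucc (spinHalfPauli 0) * onSite i.succ (spinHalfPauli 0) +
          onSite i.castSucc (spinHalfPauli 1) * onSite i.succ (spinHalfPauli 1)) :=
    fun i => hop_add_conjTranspose_eq (Fin.castSucc_lt_succ (i := i)).ne
  simp only [hhop]
  rw [← Finset.smul_sum, Finset.sum_sub_distrib, ← Finset.smul_sum]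
  module

end Literature.MathematicalPhysics.QuantumLattice


end
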